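import Mathlib
import HarnessLib
import Summits.KontsevichZagierPeriods.KontsevichZagierPeriods.Theorems.LinRedNormalFormDihedralNormalFormStubNestedReductionAux7
import Summits.KontsevichZagierPeriods.KontsevichZagierPeriods.Theorems.LinRedNormalFormDihedralNormalFormStubNestedReductionAux8
import Summits.KontsevichZagierPeriods.KontsevichZagierPeriods.Theorems.LinRedNormalFormDihedralNormalFormStubNestedReductionAux13
import Summits.KontsevichZagierPeriods.KontsevichZagierPeriods.Theorems.LinRedNormalFormDihedralNormalFormStubNestedReductionAux16
import Summits.KontsevichZagierPeriods.KontsevichZagierPeriods.Theorems.LinRedNormalFormDihedralNormalFormStubAtomConvergence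

/-!
# `DihedralNormalForm`, line `torus-descent-sum-shadow`, stub `stub_nestedReduction` (THEOREM N)

The stub `stub_nestedReduction` (THEOREM N) of the crux `DihedralNormalForm`
(stmt-KontsevichZagierPeriods-3912, route `LinRedNormalForm`): **phase (N2) — lowering kernel
multiplicities** (`Nested.levelA`).  A convergent prefix-nested atom `[q, a, e]` with a kernel
chord `[0,p]` of exponent `e 0 p ≤ −2` is treated by the shift `[a,e] = [a + 𝟙_{[0,p]}, e] +
[a, e + δ_{[0,p]}]` (rule 1b) and ONE Newton–Leibniz move along `x_p` (Aux 7 `Nested.atomAxisNL`)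
with the atom-shaped primitive `(q/(m−1))·[a + 𝟙_p, e + δ_{[0,p]}]`, `m = −e 0 p`: its
`[0,p]`-term is `−[a + 𝟙_{[0,p]}, e]`, all other terms and the shifted atom have smaller potential
`phi2` (Aux 10), the base is an atom of one dimension less (Aux 8) or zero.  Every term is
absolutely convergent by the convergence criterion (both halves, hypotheses `hsuf`, `hnec`) and
the `α`-bookkeeping of Aux 9/10.  Strong induction on `phi2`; at `phi2`-minimal data with no such
chord, phase (N3) (`Nested.levelB`, Aux 13) applies.

Finally **the stub**: dimension `0` is the word atom of the empty word; in dimension `m + 1` a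
nested atom is relabelled into a prefix-nested one (Aux 16, one change-of-variables move) and
phase (N2) applies, both halves of the convergence criterion being the tool theorem
`atomConvergence`.

References: M. Kontsevich, D. Zagier, *Periods* (2001), §1.2, rules (1), (3).
-/

noncomputable section

open MeasureTheory Set

namespace Summit.KontsevichZagierPeriods.DihedralNormalForm.TorusDescent

open Literature.NumberTheory.Transcendental

namespace Nested

variable {m : ℕ}

/-- Changing an exponent in the row of `0` keeps prefix-nestedness. -/
theorem prefix_eadd_row {e : Fin (m + 1) → Fin (m + 1) → ℤ}
    (hPN : ∀ i j : Fin (m + 1), i < j → e i j ≠ 0 → (i : ℕ) = 0) (j₀ : Fin (m + 1)) (c : ℤ)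
    (i j : Fin (m + 1)) (hij : i < j) (hne : eadd e 0 j₀ c i j ≠ 0) : (i : ℕ) = 0 := by
  rw [eadd_apply] at hne
  by_cases h : i = 0 ∧ j = j₀
  · rw [h.1]; rfl
  · rw [if_neg h, add_zero] at hne; exact hPN i j hij hne

/-- Changing a singleton exponent keeps prefix-nestedness. -/
theorem prefix_eadd_diag {e : Fin (m + 1) → Fin (m + 1) → ℤ}
    (hPN : ∀ i j : Fin (m + 1), i < j → e i j ≠ 0 → (i : ℕ) = 0) (l : Fin (m + 1)) (c : ℤ)
    (i j : Fin (m + 1)) (hij : i < j) (hne : eadd e l l c i j ≠ 0) : (i : ℕ) = 0 := by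
  rw [eadd_apply, if_neg, add_zero] at hne
  · exact hPN i j hij hne
  · rintro ⟨h1, h2⟩; rw [h1, h2] at hij; exact lt_irrefl _ hij

/-- **Phase (N2).**  Prefix-nested atoms reduce to the target, given both halves of the
convergence criterion in dimension `m + 1`. -/
theorem levelA
    (hsuf : ∀ (q : ℚ) (a : Fin (m + 1) → ℕ) (e : Fin (m + 1) → Fin (m + 1) → ℤ),
      (∀ i j : Fin (m + 1), i ≤ j → 0 ≤ alphaS e i j) → IntegrableOn (atomQ (m + 1) q a e) (ocube (m + 1)))
    (hnec : ∀ (q : ℚ) (a : Fin (m + 1) → ℕ) (e : Fin (m + 1) → Fin (m + 1) → ℤ)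
      (s : KZ.IntegralRep (m + 1)), q ≠ 0 → s.domain = ocube (m + 1) →
      EqOn s.integrand (atomQ (m + 1) q a e) s.domain → ∀ i j : Fin (m + 1), i ≤ j → 0 ≤ alphaS e i j) :
    ∀ (N : ℕ) (e : Fin (m + 1) → Fin (m + 1) → ℤ), phi2 e = N →
      (∀ i j : Fin (m + 1), i < j → e i j ≠ 0 → (i : ℕ) = 0) →
      ∀ (q : ℚ) (a : Fin (m + 1) → ℕ) (s : KZ.IntegralRep (m + 1)), s.domain = ocube (m + 1) →
        EqOn s.integrand (atomQ (m + 1) q a e) s.domain →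
        ∃ M ∈ Target (m + 1), KZ.of s - M ∈ KZ.relations := by
  intro N
  induction N using Nat.strong_induction_on with
  | _ N IH =>
  intro e hN hPN q a s hs hi
  by_cases hq : q = 0
  · subst hq; exact goal_of_q_zero a e s hi
  have hα := hnec q a e s hq hs hi
  by_cases hex : ∃ p : Fin (m + 1), (p : ℕ) ≠ 0 ∧ e 0 p ≤ -2
  swap
  · -- no kernel multiplicity `≥ 2`: phase (N3)
    push Not at hex
    refine levelB hsuf _ e rfl hPN (fun i j hij => ?_)
      (fun l => by have h := hα l l le_rfl; rwa [alphaS_self] at h) q a s hs hi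
    by_cases h0 : e i j = 0
    · omega
    · have hi0 : i = 0 := Fin.ext (hPN i j hij h0)
      subst hi0
      have hj : (j : ℕ) ≠ 0 := fun h => by
        have : j = 0 := Fin.ext h
        rw [this] at hij; exact lt_irrefl _ hij
      have := hex j hj
      omega
  obtain ⟨p, hp, hep⟩ := hex
  have hp0 : (0 : Fin (m + 1)) ≠ p := fun h => hp (by rw [← h]; rfl)
  -- the data of the step
  set et := eadd e 0 p 1 with het
  set A := aup a p p with hA
  have hm : (((-e 0 p - 1 : ℤ)) : ℚ) ≠ 0 := by exact_mod_cast (show (-e 0 p - 1 : ℤ) ≠ 0 by omega)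
  set c : ℚ := q / ((-e 0 p - 1 : ℤ) : ℚ) with hc
  have hPNt : ∀ i j : Fin (m + 1), i < j → et i j ≠ 0 → (i : ℕ) = 0 := prefix_eadd_row hPN p 1
  have hαt : ∀ i j : Fin (m + 1), i ≤ j → 0 ≤ alphaS et i j := alphaS_eadd_one_nonneg hα 0 p
  have hetpp : et p p = e p p := by rw [het, eadd_apply, if_neg (fun h => hp0 h.1.symm), add_zero]
  have hepp : 0 ≤ e p p := by have h := hα p p le_rfl; rwa [alphaS_self] at h
  have hlt1 : phi2 et < N := hN ▸ phi2_eadd_one_lt hp hep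
  have h0p : ((0 : Fin (m + 1)), p) ∈ thru p := mem_thru.mpr ⟨Fin.zero_le p, le_rfl⟩
  -- the representations: shifted atom, lowered atom, the terms of `∂_p F`
  set sG := atomRep (m + 1) q (aup a 0 p) e (hsuf _ _ _ hα) with hsG
  set s1 := atomRep (m + 1) q a et (hsuf _ _ _ hαt) with hs1
  have hRa_int : IntegrableOn (atomQ (m + 1) (c * A p) (adown A p) et) (ocube (m + 1)) := by
    rw [hA, adown_aup]; exact hsuf _ _ _ hαt
  set Ra := atomRep (m + 1) (c * A p) (adown A p) et hRa_int with hRa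
  set coef : Fin (m + 1) × Fin (m + 1) → ℚ := fun ij =>
    if ij ∈ thru p then c * et ij.1 ij.2 else 0 with hcoef
  -- classification of the non-zero terms through `p`, other than `[0,p]`
  have hclass : ∀ ij ∈ thru p, et ij.1 ij.2 ≠ 0 → ij ≠ (0, p) →
      (ij = (p, p) ∧ 1 ≤ e p p) ∨ (ij.1 = 0 ∧ p < ij.2) := by
    intro ij hij hne hne0
    obtain ⟨hip, hpj⟩ := mem_thru.mp hij
    rcases eq_or_lt_of_le (hip.trans hpj) with heq | hlt
    · have h1 : ij.1 = p := le_antisymm hip (heq ▸ hpj)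
      have h2 : ij.2 = p := heq ▸ h1
      refine Or.inl ⟨Prod.ext h1 h2, ?_⟩
      rw [h1, h2, hetpp] at hne
      omega
    · have hi0 : ij.1 = 0 := Fin.ext (hPNt _ _ hlt hne)
      refine Or.inr ⟨hi0, lt_of_le_of_ne hpj fun h => hne0 (Prod.ext hi0 h.symm)⟩
  have hint : ∀ ij, IntegrableOn (atomQ (m + 1) (coef ij) (aterm A p ij.1 ij.2) (esub et ij.1 ij.2))
      (ocube (m + 1)) := by
    intro ij
    by_cases hij : ij ∈ thru p
    swap
    · rw [hcoef]; simp only [if_neg hij]; exact integrableOn_atomQ_zero _ _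
    rw [hcoef]; simp only [if_pos hij]
    by_cases h0 : et ij.1 ij.2 = 0
    · rw [h0, Int.cast_zero, mul_zero]; exact integrableOn_atomQ_zero _ _
    by_cases h0p' : ij = (0, p)
    · rw [h0p']
      refine hsuf _ _ _ ?_
      rw [esub_eq_eadd, het, eadd_eadd_cancel]
      exact hα
    rcases hclass ij hij h0 h0p' with ⟨rfl, hb⟩ | ⟨hi0, hpj⟩
    · refine hsuf _ _ _ ?_
      rw [esub_eq_eadd, het]
      exact alphaS_bterm_nonneg hPN hα (z := 0) rfl hb
    · refine hsuf _ _ _ ?_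
      rw [esub_eq_eadd, hi0, het]
      exact alphaS_outer_nonneg hα (Fin.zero_le p) hpj.le
  set Rt : Fin (m + 1) × Fin (m + 1) → KZ.IntegralRep (m + 1) := fun ij =>
    atomRep (m + 1) (coef ij) (aterm A p ij.1 ij.2) (esub et ij.1 ij.2) (hint ij) with hRt
  -- the axis Newton–Leibniz move
  obtain ⟨rb, hrbd, hrbi, hNL⟩ := atomAxisNL p c A et (by rw [hA]; simp [aup])
    (by rw [hetpp]; exact hepp) Ra rfl (fun _ _ => rfl) Rt (fun _ _ => rfl)
    (fun ij hij x _ => by simp only [hRt, atomRep_integrand, hcoef, if_pos hij])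
  -- the shift and the sign identity `Rt (0,p) = −sG`
  have hshift : KZ.of s - KZ.of sG - KZ.of s1 ∈ KZ.relations :=
    shift_mem_relations q a e (Fin.zero_le p) s sG s1 hs rfl rfl hi (fun _ _ => rfl) (fun _ _ => rfl)
  have hopp : KZ.of sG + KZ.of (Rt (0, p)) ∈ KZ.relations := by
    refine KZ.of_add_of_mem_relations_of_eqOn_neg rfl fun x _ => ?_
    have hcq : coef (0, p) = -q := by
      have hep' : (e 0 p : ℚ) ≤ -2 := by exact_mod_cast hep
      have hm1 : (-(e 0 p : ℚ) - 1) ≠ 0 := by intro h; linarith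
      have hm2 : (-1 - (e 0 p : ℚ)) ≠ 0 := by intro h; linarith
      rw [hcoef]
      simp only [if_pos h0p]
      rw [show et 0 p = e 0 p + 1 by rw [het, eadd_apply, if_pos ⟨rfl, rfl⟩], hc]
      push_cast
      field_simp
      ring
    simp only [hRt, hsG, atomRep_integrand, Pi.neg_apply]
    rw [hcq, show aterm A p (0 : Fin (m + 1)) p = aup a 0 p from aterm_aup a (Fin.zero_le p) le_rfl,
      show esub et (0 : Fin (m + 1)) p = e by rw [esub_eq_eadd, het, eadd_eadd_cancel], atomQ_neg]
  -- reductions of the pieces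
  obtain ⟨M1, hM1, r1⟩ := IH _ hlt1 et rfl hPNt q a s1 rfl (fun _ _ => rfl)
  obtain ⟨MA, hMA, rA⟩ := IH _ hlt1 et rfl hPNt (c * A p) (adown A p) Ra rfl (fun _ _ => rfl)
  have redT : ∀ ij, ∃ M ∈ Target (m + 1), ij ∈ (thru p).erase (0, p) → KZ.of (Rt ij) - M ∈ KZ.relations := by
    intro ij
    by_cases hij : ij ∈ (thru p).erase (0, p)
    swap
    · exact ⟨0, zero_mem _, fun h => absurd h hij⟩
    obtain ⟨hne0, hij'⟩ := Finset.mem_erase.mp hij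
    by_cases h0 : et ij.1 ij.2 = 0
    · refine ⟨0, zero_mem _, fun _ => ?_⟩
      rw [sub_zero]
      refine KZ.of_mem_relations_of_eqOn_zero _ fun x _ => ?_
      simp only [hRt, atomRep_integrand, hcoef, if_pos hij', h0, Int.cast_zero, mul_zero, Pi.zero_apply]
      simp [atomQ]
    rcases hclass ij hij' h0 hne0 with ⟨hpp, -⟩ | ⟨hi0, hpj⟩
    · -- the b-byproduct: exponents `eadd et p p (−1)`, same `phi2`
      obtain ⟨M, hM, hr⟩ := IH (phi2 (eadd et p p (-1))) (by rw [phi2_eadd_diag _ hp]; exact hlt1) _ rfl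
        (prefix_eadd_diag hPNt p (-1)) (coef ij) (aterm A p ij.1 ij.2) (Rt ij) rfl
        (fun x _ => by simp only [hRt, atomRep_integrand, hpp, esub_eq_eadd])
      exact ⟨M, hM, fun _ => hr⟩
    · -- an outer byproduct: exponents `eadd et 0 j (−1)`, smaller `phi2`
      obtain ⟨M, hM, hr⟩ := IH (phi2 (eadd et 0 ij.2 (-1))) (hN ▸ phi2_outer_lt hp hep hpj) _ rfl
        (prefix_eadd_row hPNt ij.2 (-1)) (coef ij) (aterm A p ij.1 ij.2) (Rt ij) rfl
        (fun x _ => by simp only [hRt, atomRep_integrand, esub_eq_eadd, hi0])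
      exact ⟨M, hM, fun _ => hr⟩
  choose Mt hMt hrt using redT
  have rT : ∑ ij ∈ (thru p).erase (0, p), KZ.of (Rt ij) - ∑ ij ∈ (thru p).erase (0, p), Mt ij ∈
      KZ.relations := by
    rw [← Finset.sum_sub_distrib]
    exact KZ.relations.sum_mem fun ij hij => hrt ij hij
  have redB : ∃ Mb ∈ Target (m + 1), KZ.of rb - Mb ∈ KZ.relations := by
    by_cases hE0 : et p p = 0
    · obtain ⟨A', E', hAE⟩ := exists_base_atom c A hE0
      refine ⟨KZ.of rb, of_mem_target_of_lt (Nat.lt_succ_self m) c A' E' rb hrbd (fun y hy => ?_), by simp⟩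
      rw [hrbi]
      exact hAE y (hrbd ▸ hy)
    · refine ⟨0, zero_mem _, ?_⟩
      rw [sub_zero]
      exact KZ.of_mem_relations_of_eqOn_zero rb fun y _ => by rw [hrbi]; exact base_eq_zero c A hE0 y
  obtain ⟨Mb, hMb, rB⟩ := redB
  -- assembly
  rw [← Finset.add_sum_erase _ _ h0p] at hNL
  refine ⟨M1 - MA + ∑ ij ∈ (thru p).erase (0, p), Mt ij + Mb,
    add_mem (add_mem (sub_mem hM1 hMA) (sum_mem fun ij _ => hMt ij)) hMb, ?_⟩
  have := add_mem (add_mem (sub_mem (add_mem (add_mem (add_mem hshift hopp) hNL) r1) rA) rT) rB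
  convert this using 1
  abel

end Nested

/-- **THEOREM N (`stub_nestedReduction`).**  A NESTED cubical atom (active chords of length `≥ 2`
pairwise `⊆`-comparable) is congruent modulo `KZ.relations` to a `ℤ`-combination of word atoms,
SD1-directed atoms and atoms of lower dimension: relabel the coordinates by depth (prefix-nested
form, `Nested.exists_prefix_reindex`), then lower the kernel multiplicities by shift + axis
Newton–Leibniz (`Nested.levelA`), peel the numerator factors (`Nested.levelB`) and normalise the
simple prefix chains into word atoms (`Nested.levelC`); the convergence criterion
`atomConvergence` supplies absolute convergence of every byproduct and the shape of the input. -/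
theorem stub_nestedReduction : ∀ (k : ℕ) (q : ℚ) (a : Fin k → ℕ) (e : Fin k → Fin k → ℤ) (s : Literature.NumberTheory.Transcendental.KZ.IntegralRep k), s.domain = {x : Fin k → ℝ | ∀ i, x i ∈ Set.Ioo (0:ℝ) 1} → Set.EqOn s.integrand (fun x => (q : ℝ) * ((∏ i : Fin k, x i ^ a i) * ∏ i : Fin k, ∏ j : Fin k, if i ≤ j then (1 - (∏ l : Fin k, if i ≤ l ∧ l ≤ j then x l else 1)) ^ e i j else 1)) s.domain → (∀ i j i' j' : Fin k, i < j → i' < j' → e i j ≠ 0 → e i' j' ≠ 0 → (i ≤ i' ∧ j' ≤ j) ∨ (i' ≤ i ∧ j ≤ j')) → ∃ m ∈ AddSubgroup.closure ({z : Literature.NumberTheory.Transcendental.KZ.FormalRep | ∃ (q : ℚ) (ε : Fin k → Bool) (s : Literature.NumberTheory.Transcendental.KZ.IntegralRep k), s.domain = {x : Fin k → ℝ | ∀ i, x i ∈ Set.Ioo (0:ℝ) 1} ∧ Set.EqOn s.integrand (fun x => (q : ℝ) * ((∏ i : Fin k, x i ^ (k - 1 - (i : ℕ))) * ∏ i : Fin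 k, if ε i then 1 / (1 - (∏ l : Fin k, if l ≤ i then x l else 1)) else 1 / (∏ l : Fin k, if l ≤ i then x l else 1))) s.domain ∧ z = Literature.NumberTheory.Transcendental.KZ.of s} ∪ {z : Literature.NumberTheory.Transcendental.KZ.FormalRep | ∃ (q : ℚ) (a : Fin k → ℕ) (e : Fin k → Fin k → ℤ) (s : Literature.NumberTheory.Transcendental.KZ.IntegralRep k), (∃ lam : Fin k → ℤ, (∀ l : Fin k, lam l = 0 ∨ lam l = 1 ∨ lam l = -1) ∧ (∃ p : Fin k, lam p = -1) ∧ (Finset.univ.filter (fun l : Fin k => lam l = 1)).card ≤ 1 ∧ (∀ i j : Fin k, i ≤ j → e i j ≠ 0 → (∑ l : Fin k, if i ≤ l ∧ l ≤ j then lam l else 0) = 0) ∧ (∑ l : Fin k, lam l * ((a l : ℤ) + 1)) ≠ 0) ∧ s.domain = {x : Fin k → ℝ | ∀ i, x i ∈ Set.Ioo (0:ℝ) 1} ∧ Set.EqOn s.integrand (fun x => (q : ℝ) * ((∏ i : Fin k, x i ^ a i) * ∏ i : Fin k, ∏ j : Fin k, if i ≤ j then (1 - (∏ l : Fin k, if i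 ≤ l ∧ l ≤ j then x l else 1)) ^ e i j else 1)) s.domain ∧ z = Literature.NumberTheory.Transcendental.KZ.of s} ∪ {z : Literature.NumberTheory.Transcendental.KZ.FormalRep | ∃ d : ℕ, d < k ∧ z ∈ {z : Literature.NumberTheory.Transcendental.KZ.FormalRep | ∃ (q : ℚ) (a : Fin d → ℕ) (e : Fin d → Fin d → ℤ) (s : Literature.NumberTheory.Transcendental.KZ.IntegralRep d), s.domain = {x : Fin d → ℝ | ∀ i, x i ∈ Set.Ioo (0:ℝ) 1} ∧ Set.EqOn s.integrand (fun x => (q : ℝ) * ((∏ i : Fin d, x i ^ a i) * ∏ i : Fin d, ∏ j : Fin d, if i ≤ j then (1 - (∏ l : Fin d, if i ≤ l ∧ l ≤ j then x l else 1)) ^ e i j else 1)) s.domain ∧ z = Literature.NumberTheory.Transcendental.KZ.of s}}), Literature.NumberTheory.Transcendental.KZ.of s - m ∈ Literature.NumberTheory.Transcendental.KZ.relations := by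
  intro k q a e s hdom hint hN
  cases k with
  | zero => exact Nested.nested_zero q a e s hdom hint
  | succ m =>
    obtain ⟨a', e', s', hPN, hs', hi', hrel⟩ := Nested.exists_prefix_reindex q a e hN s hdom hint
    have hsuf : ∀ (q : ℚ) (a : Fin (m + 1) → ℕ) (e : Fin (m + 1) → Fin (m + 1) → ℤ),
        (∀ i j : Fin (m + 1), i ≤ j → 0 ≤ Nested.alphaS e i j) →
        IntegrableOn (Nested.atomQ (m + 1) q a e) (Nested.ocube (m + 1)) := by
      intro q a e hα
      by_cases hq : q = 0
      · subst hq; exact Nested.integrableOn_atomQ_zero a e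
      · exact (atomConvergence (m + 1) q a e hq).mpr hα
    have hnec : ∀ (q : ℚ) (a : Fin (m + 1) → ℕ) (e : Fin (m + 1) → Fin (m + 1) → ℤ)
        (s : KZ.IntegralRep (m + 1)), q ≠ 0 → s.domain = Nested.ocube (m + 1) →
        EqOn s.integrand (Nested.atomQ (m + 1) q a e) s.domain →
        ∀ i j : Fin (m + 1), i ≤ j → 0 ≤ Nested.alphaS e i j := by
      intro q a e s hq hs hi
      have hI : IntegrableOn (Nested.atomQ (m + 1) q a e) (Nested.ocube (m + 1)) :=
        hs ▸ s.integrableOn.congr_fun hi (KZ.IntegralRep.measurableSet_domain_holds s)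
      exact (atomConvergence (m + 1) q a e hq).mp hI
    obtain ⟨M, hM, hr⟩ := Nested.levelA hsuf hnec _ e' rfl hPN q a' s' hs' hi'
    refine ⟨M, hM, ?_⟩
    have := add_mem hrel hr
    rwa [sub_add_sub_cancel] at this

end Summit.KontsevichZagierPeriods.DihedralNormalForm.TorusDescent
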